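import Literature.Geometry.Lorentzian.KerrIntegratedDecay
import HarnessLib

/-!
# Integrated local energy decay on sub-extremal Kerr with the printed `a₀`-uniform constant
# (Dafermos–Rodnianski–Shlapentokh-Rothman, Thm. 3.2 (25), named fact)

`KerrIntegratedDecay.lean` transcribes display (25) of Dafermos–Rodnianski–Shlapentokh-Rothman,
arXiv:1402.7034, Thm. 3.2, as the named fact `DafermosRodnianskiShlapentokhRothman2016_integratedDecay`
with the quantifiers `∀ (M, a) sub-extremal, ∃ R₀, …, ∃ C`: the constant is chosen AFTER the spin `a`, and
its docstring records that the clause "for all `|a'| ≤ a₀`" of arXiv:1010.5132, Def. 4.1 (i) is not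
transcribed. The printed theorem is uniform: §3.2–§3.3 (p. 14) of arXiv:1402.7034 fix `0 ≤ a₀ < M`
first and state (25) "for all `|a| ≤ a₀`" with "a constant `C` depending only on `a₀`, `M`" (and on
`δ`, `j`); the red-shift vector field `N` of arXiv:1010.5132, Def. 4.1 / Prop. 4.5.1 is constructed
for the whole range `|a| ≤ a₀`, with `N = T` for `r ≥ r₁(a₀, M)`. This file adds that uniform reading as
a second named fact, in exactly the vendored form of `KerrIntegratedDecay.lean` (same hypersurfaces
`{t*_KS = F(y)}`, same class `IsAdmissibleKerrWaveOn M a F`, same right-hand side), only with the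
quantifiers `∀ a₀ < M, ∃ R₀, …, ∃ C, ∀ |a| ≤ a₀`:

* `DafermosRodnianskiShlapentokhRothman2016_integratedDecay_uniform` — the named fact;
* `DafermosRodnianskiShlapentokhRothman2016_integratedDecay_of_uniform` — sanity: it implies the
  non-uniform fact (take `a₀ := |a|`).

Why a second fact: κ-explicit statements near extremality (the crux `PhaseMixingCapture.KappaExplicitWaveDecay`
of the summit `FinalStateConjecture`) quote the theorem on a range `|a| ≤ a₁` with `a₁ < M` fixed in
terms of `M`, and need ONE constant there; the non-uniform fact does not record the continuity in `a`
that would give it. Nothing is proved here about (25) itself (D-0014: the 127-page proof is not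
reproduced); discharging this fact discharges the non-uniform one.

## References

* M. Dafermos, I. Rodnianski, Y. Shlapentokh-Rothman, *Decay for solutions of the wave equation
  on Kerr exterior spacetimes III: the full subextremal case `|a| < M`*, Ann. of Math. 183 (2016)
  787–913, arXiv:1402.7034: §3.2 Thm. 3.2 (25), §3.3 (p. 14: `0 ≤ a₀ < M`, "constant depending only
  on `a₀`, `M`"), §4.1, Prop. 4.5.1 (key `DafermosRodnianskiShlapentokhrothman2014`).
* M. Dafermos, I. Rodnianski, arXiv:1010.5132, §4.4 Def. 4.1 (i) ("for all `|a| ≤ a₀`"), Prop. 4.5.1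
  (key `DafermosRodnianski2010KerrSmallA`).
-/

noncomputable section

open Set Filter MeasureTheory Metric TopologicalSpace
open scoped Topology ENNReal Manifold ContDiff

namespace Literature.Geometry.Lorentzian

/-- **Dafermos–Rodnianski–Shlapentokh-Rothman, integrated local energy decay on sub-extremal Kerr
with the printed `a₀`-UNIFORM constant** (Ann. of Math. 183 (2016) = arXiv:1402.7034, Thm. 3.2,
display (25), with §3.3 p. 14: "`0 ≤ a₀ < M` … for all `|a| ≤ a₀` … `C` depends only on `a₀`, `M`").
Vendored form word for word as in `DafermosRodnianskiShlapentokhRothman2016_integratedDecay`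
(`KerrIntegratedDecay.lean`: Kerr–Schild graphs `{t*_KS = F(y)}` flat on a ball of radius `ρ ≥ R₀`,
the class `IsAdmissibleKerrWaveOn M a F`, `∫₀^∞ E_loc(τ, R) dτ` on the left, the second-order flat
data energy plus the first-order far energies of `ψ` and `Tψ` on the right), with the ONLY change that
`a₀ < M` is fixed first and the radius `R₀ = R₀(M, a₀)` (beyond which `N = T`; `r₁(a, M)` of
arXiv:1010.5132, Prop. 4.5.1, constructed there for the whole range `|a| ≤ a₀`, Def. 4.1 (i)) and the
constant `C = C(M, a₀, F, ρ, R)` serve every spin `|a| ≤ a₀` (such spins are sub-extremal). The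
127-page proof is not reproduced: this is a named fact (D-0014); it implies the non-uniform fact
(`DafermosRodnianskiShlapentokhRothman2016_integratedDecay_of_uniform`).
[cite: DafermosRodnianskiShlapentokhrothman2014, Thm. 3.2 (25) with §3.3 (p. 14)] -/
def DafermosRodnianskiShlapentokhRothman2016_integratedDecay_uniform : Prop :=
  ∀ [Kerr.Facts] [Kerr.SliceFacts] (M a₀ : ℝ), 0 ≤ a₀ → a₀ < M →
    ∃ R₀ : ℝ, 0 < R₀ ∧ ∀ (F : E3 → ℝ) (ρ : ℝ), Kerr.IsAdmissibleHeight M F → R₀ ≤ ρ →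
      (∀ y : E3, ‖y‖ ≤ ρ → F y = 0) → ∀ R : ℝ, R ≤ ρ →
      ∃ C : ℝ≥0∞, C < ⊤ ∧ ∀ a : ℝ, |a| ≤ a₀ →
        ∀ ψ : Kerr.exterior M a → ℝ, IsAdmissibleKerrWaveOn M a F ψ →
        ∫⁻ τ in Ioi (0 : ℝ), localSliceEnergy (Kerr.exterior M a) ψ τ R ≤
          C * (sliceSobolevEnergy (Kerr.exterior M a) ψ 0 2 0 (closedBall (0 : E3) ρ) +
            graphSliceEnergyOn (Kerr.exterior M a) ψ F 0 {y | ρ < ‖y‖} +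
            graphSliceEnergyOn (Kerr.exterior M a) (timeDeriv ψ) F 0 {y | ρ < ‖y‖})

/-- **The uniform fact implies the non-uniform one** (`KerrIntegratedDecay.lean`): for a sub-extremal
spin `a` take `a₀ := |a|`. [cite: DafermosRodnianskiShlapentokhrothman2014, Thm. 3.2 (25)] -/
theorem DafermosRodnianskiShlapentokhRothman2016_integratedDecay_of_uniform
    (h : DafermosRodnianskiShlapentokhRothman2016_integratedDecay_uniform) :
    DafermosRodnianskiShlapentokhRothman2016_integratedDecay := by
  intro instF instS M a hMa
  obtain ⟨R₀, hR₀, h'⟩ := @h instF instS M |a| (abs_nonneg a) hMa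
  refine ⟨R₀, hR₀, fun F ρ hF hρ hF0 R hR ↦ ?_⟩
  obtain ⟨C, hC, hC'⟩ := h' F ρ hF hρ hF0 R hR
  exact ⟨C, hC, fun ψ hψ ↦ hC' a le_rfl ψ hψ⟩

end Literature.Geometry.Lorentzian

end
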